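import Summits.Ventures.CertifiedManyBodySolver.Downfold.TPrimePinnedPairRowKernel
import HarnessLib

/-!
# The pinned-vertex row for a certificate issued at ANY anchor `(t′_v, U_v)` of the `(t′, U)` plane, read in a torus-limit ground state at
# `(t′, U)`: `pinnedVertexRow₂_of_windowIdentity` + `pinnedStationarity₂` (cell `pub/hubbard-obs` × `pub/hubbard-downfold`; seat
# `hubbard-cov-la214-unc-2`, lineage desk; zero compute)

HONEST FRAMING: soundness PLUMBING, the two-coupling generalisation of `Downfold/TPrimePinnedPairRowKernel.lean` (p665976: vertex and state
differ in `t′` only). Here the vertex identity is issued at `(1, sv, Uv)` and the state is a torus-limit ground state at `(1, s, U)`: BOTH conjugate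
observables appear — the diagonal-hopping energy `K₂ω = e_{Φ(0,1,0)}(ω)` and the double-occupancy density `Dω = e_{Φ(0,0,1)}(ω)` — and the shared
eom functional splits in THREE: `E₀₀` (`H^{(1,0,0)}`), `E₁` (`T′`), `E₂` (`D`). The U-direction pinned pairs of the Hg-1201 / NdNiO₂ cells
(`Rows/DopedTLCorrPinnedPairU.lean`: `SquareTTPrimePinnedPairRowU`, vertex `(s, U_v)`, state `(s, U)`) and the t′-direction pairs of La214 are the two
axes; a twin writer instantiates `sv := s` (U-pairs: the `K₂` terms vanish) or `Uv := U` (t′-pairs: the `D` terms vanish). Nothing is asserted: no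
`def`, no named fact, no `sorry`, no number; no claim node is discharged; CONTROL / CALIBRATION wording class (xx1); no summit statement is proved here.

* §1 `localHamiltonian_two_split`: `H^{(1,c,u)}_{Λ'} = H^{(1,0,0)}_{Λ'} + c·T′_{Λ'} + u·D_{Λ'}` and the eom split `eom_two_split`;
* §2 `pinnedVertexRow₂_of_windowIdentity`: identity at `(1, sv, Uv)` (cap/cut rows on `ΓE^{(1,sv,Uv)}`, eom on words `B_k`) read in a torus-limit
  ground state at `(1, s, U)` (`U ≥ 0`, filling `n ∈ [0,2)`):
  `(c − Σ‖a‖ + (Σμ)(n/2 − ν)) + κ(cap − e + (s − sv)K₂ω + (U − Uv)Dω) + κ'(e − (s − sv)K₂ω − (U − Uv)Dω − fl) + (E₀₀ω + sv·E₁ω + Uv·E₂ω)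
   ≤ |S|⁻¹Σ_γ Re (ω∘γ)_{Λ'}(Xv)` (`e = e₀(1,s,U,n)`; `IsTorusLimitOf.re_expect_d4Emb_meanEnergyObs` + `meanEnergy_hubbardTTPrime_affine`);
* §3 `pinnedStationarity₂`: `E₀₀ω + s·E₁ω + U·E₂ω = 0`.

References: D. P. Bertsekas, *Nonlinear Programming* (1999) Prop. 5.1.3 [Bertsekas1999NonlinearProgramming]; J. Wang et al., PRX 14 (2024) 031006
§III [WangEtAl2024]; X. Han, arXiv:2006.06002 §3 [Han2020Bootstrap]; T. Koma, H. Tasaki, J. Stat. Phys. 76 (1994) 745 §1 [KomaTasaki1994].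
-/

noncomputable section

namespace Summit.Ventures.CertifiedManyBodySolver.Downfold

open Literature.MathematicalPhysics.QuantumLattice
open Matrix HubbardWave0 Literature.Probability.LatticeModels ThermodynamicLimit Filter Topology
open Literature.MathematicalPhysics.QuantumManyBody.StateRelaxation
open Summit.Ventures.CertifiedManyBodySolver.Observables
open scoped BigOperators ComplexOrder

/-! ## §1  Algebra: the two-coupling split -/

section Split

variable {Λ Λ' : Finset (Site 2)}

/-- `H^{(1,c,u)}_{Λ'} = H^{(1,0,0)}_{Λ'} + c·T′_{Λ'} + u·D_{Λ'}` (`hubbardTTPrimeFermionInteraction_taylor`). [cite: XuEtAl2024, eq. (1)] -/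
theorem localHamiltonian_two_split (c u : ℝ) (Λ' : Finset (Site 2)) :
    (hubbardTTPrimeFermionInteraction 1 c u).localHamiltonian Λ' =
      (hubbardTTPrimeFermionInteraction 1 0 0).localHamiltonian Λ' +
        ((c : ℝ) : ℂ) • (hubbardTTPrimeFermionInteraction 0 1 0).localHamiltonian Λ' +
        ((u : ℝ) : ℂ) • (hubbardTTPrimeFermionInteraction 0 0 1).localHamiltonian Λ' := by
  have h := FermionInteraction.localHamiltonian_of_add_smul_smul
    (Ψ := hubbardTTPrimeFermionInteraction 1 c u) (Ψ₀ := hubbardTTPrimeFermionInteraction 1 0 0)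
    (Ψ₁ := hubbardTTPrimeFermionInteraction 0 1 0) (Ψ₂ := hubbardTTPrimeFermionInteraction 0 0 1)
    (c₁ := ((c - 0 : ℝ) : ℂ)) (c₂ := ((u - 0 : ℝ) : ℂ))
    (fun X => hubbardTTPrimeFermionInteraction_taylor 1 c u 0 0 X) Λ'
  rw [h, sub_zero, sub_zero]

/-- The eom family splits accordingly: `Σ_k [H^{(1,c,u)}_{Λ'}, ΓB_k] = Σ_k [H^{(1,0,0)}, ΓB_k] + c·Σ_k [T′, ΓB_k] + u·Σ_k [D, ΓB_k]`.
[cite: Han2020Bootstrap, §3] -/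
theorem eom_two_split (c u : ℝ) (hΛ : Λ ⊆ Λ') {κ' : Type*} (s : Finset κ') (B : κ' → FermionOp Λ) :
    ∑ k ∈ s, ((hubbardTTPrimeFermionInteraction 1 c u).localHamiltonian Λ' * fermionEmbed (PolySite.incl hΛ) (B k) -
        fermionEmbed (PolySite.incl hΛ) (B k) * (hubbardTTPrimeFermionInteraction 1 c u).localHamiltonian Λ') =
      ∑ k ∈ s, ((hubbardTTPrimeFermionInteraction 1 0 0).localHamiltonian Λ' * fermionEmbed (PolySite.incl hΛ) (B k) -
          fermionEmbed (PolySite.incl hΛ) (B k) * (hubbardTTPrimeFermionInteraction 1 0 0).localHamiltonian Λ') +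
        ((c : ℝ) : ℂ) • ∑ k ∈ s, ((hubbardTTPrimeFermionInteraction 0 1 0).localHamiltonian Λ' * fermionEmbed (PolySite.incl hΛ) (B k) -
          fermionEmbed (PolySite.incl hΛ) (B k) * (hubbardTTPrimeFermionInteraction 0 1 0).localHamiltonian Λ') +
        ((u : ℝ) : ℂ) • ∑ k ∈ s, ((hubbardTTPrimeFermionInteraction 0 0 1).localHamiltonian Λ' * fermionEmbed (PolySite.incl hΛ) (B k) -
          fermionEmbed (PolySite.incl hΛ) (B k) * (hubbardTTPrimeFermionInteraction 0 0 1).localHamiltonian Λ') := by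
  rw [localHamiltonian_two_split c u Λ', Finset.smul_sum, Finset.smul_sum, ← Finset.sum_add_distrib, ← Finset.sum_add_distrib]
  refine Finset.sum_congr rfl fun k _ => ?_
  simp only [add_mul, mul_add, smul_mul_assoc, mul_smul_comm, smul_sub]
  abel

end Split

/-! ## §2  ONE VERTEX at any anchor `(sv, Uv)`, read in a torus-limit ground state at `(s, U)` -/

section Vertex

/-- **(V₂) — one pinned vertex, two couplings.** A `t–t'` window identity in `𝔄_{Λ'}` issued at `(1, sv, Uv)` (objective `Xv`, constant `c`,
density rows `μ_σ, ν`, CAP row `κ (cap·1 − ΓE_Φ^{(1,sv,Uv)})`, CUT row `κ' (ΓE_Φ^{(1,sv,Uv)} − fl·1)`, Gram / eom on words `B_k` / affine-`D₄` /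
charged / anti-Hermitian / residual families in the tree's `hcert` shape), read in a torus limit `ω` of unit sector ground states at `(1, s, U)`
(`U ≥ 0`, filling `0 ≤ n < 2`):
`(c − Σ‖a‖ + (Σμ)(n/2 − ν)) + κ (cap − e + (s − sv)K₂ω + (U − Uv)Dω) + κ' (e − (s − sv)K₂ω − (U − Uv)Dω − fl) + (E₀₀ω + sv·E₁ω + Uv·E₂ω)
 ≤ |S|⁻¹ Σ_γ Re (ω∘γ)_{Λ'}(Xv)`, `e = e₀(1,s,U,n)`, `K₂ω = e_{Φ(0,1,0)}(ω)`, `Dω = e_{Φ(0,0,1)}(ω)`, `E₀₀/E₁/E₂` = the orbit means of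
`Σ_k[H^{(1,0,0)}_{Λ'}, ΓB_k]` / `Σ_k[T′_{Λ'}, ΓB_k]` / `Σ_k[D_{Λ'}, ΓB_k]`. Proof as `pinnedVertexRow_of_windowIdentity` (route «κ := 0»).
[cite: WangEtAl2024, §III] [cite: KomaTasaki1994, §1] [cite: Bertsekas1999NonlinearProgramming, Prop. 5.1.3] -/
theorem pinnedVertexRow₂_of_windowIdentity
    {U : ℝ} (hU : 0 ≤ U) {n : ℝ} (hn0 : 0 ≤ n) (hn2 : n < 2) (sv Uv s : ℝ)
    {Λ Λ' : Finset (Site 2)} (hΛ : Λ ⊆ Λ') (h8 : thicken Λ 1 ⊆ Λ')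
    (h0 : thicken ({0} : Finset (Site 2)) 1 ⊆ Λ') (hz : (0 : Site 2) ∈ Λ')
    {S : Finset (DihedralGroup 4)} (h1 : (1 : DihedralGroup 4) ∈ S) (hmul : ∀ a ∈ S, ∀ b ∈ S, a * b ∈ S)
    (Xv : FermionOp Λ') (μ : Fin 2 → ℝ) (ν : ℝ) (cap fl κ κ' : ℚ)
    {m : Type*} [Fintype m] [DecidableEq m] {Λm : Matrix m m ℂ} (hΛm : Λm.PosSemidef) (O : m → FermionOp Λ')
    {κι : Type*} (se : Finset κι) (B : κι → FermionOp Λ)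
    {ι : Type*} (tt : Finset ι) (γ : ι → DihedralGroup 4) (hγS : ∀ l ∈ tt, γ l ∈ S) (wv : ι → Site 2)
    (hsh : ∀ l, d4ShiftSet (γ l) (wv l) Λ ⊆ Λ') (Y : ι → FermionOp Λ)
    {ρ : Type*} (uu : Finset ρ) (b : ρ → ℂ) (cw : ρ → List (Orb (PolySite Λ') × Bool))
    (hcw : ∀ j ∈ uu, ladderCharge (cw j) ≠ 0 ∨ ladderSpinCharge (cw j) ≠ 0)
    {δ : Type*} (ah : Finset δ) (dc : δ → ℝ) (V : δ → FermionOp Λ')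
    {κ'' : Type*} (w : Finset κ'') (a : κ'' → ℂ) (word : κ'' → List (Orb (PolySite Λ') × Bool)) {c : ℝ}
    (hcert : Xv - (c : ℂ) • (1 : FermionOp Λ') -
        ∑ σ : Fin 2, ((μ σ : ℝ) : ℂ) • (nAt 0 hz σ - ((ν : ℝ) : ℂ) • (1 : FermionOp Λ')) -
        (((κ : ℚ) : ℝ) : ℂ) • ((((cap : ℚ) : ℝ) : ℂ) • (1 : FermionOp Λ') -
          fermionEmbed (PolySite.incl h0) ((hubbardTTPrimeFermionInteraction 1 sv Uv).meanEnergyObs 1)) -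
        (((κ' : ℚ) : ℝ) : ℂ) • (fermionEmbed (PolySite.incl h0) ((hubbardTTPrimeFermionInteraction 1 sv Uv).meanEnergyObs 1) -
          (((fl : ℚ) : ℝ) : ℂ) • (1 : FermionOp Λ')) =
      gramForm Λm O +
        (∑ k ∈ se, ((hubbardTTPrimeFermionInteraction 1 sv Uv).localHamiltonian Λ' * fermionEmbed (PolySite.incl hΛ) (B k) -
            fermionEmbed (PolySite.incl hΛ) (B k) * (hubbardTTPrimeFermionInteraction 1 sv Uv).localHamiltonian Λ') +
          ∑ l ∈ tt, (fermionEmbed (PolySite.incl (hsh l)) (fermionEmbed (PolySite.d4Emb (γ l) (wv l) Λ) (Y l)) -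
            fermionEmbed (PolySite.incl hΛ) (Y l)) +
          ∑ j ∈ uu, b j • ladderWord (cw j)) +
        (∑ m' ∈ ah, ((dc m' : ℝ) : ℂ) • ((V m')ᴴ - V m') + ∑ k ∈ w, a k • ladderWord (word k)))
    {Ls : ℕ → ℕ} (hLs : Tendsto Ls atTop atTop)
    {ψ : ∀ L, Fock (Orb (FermionTorus 2 L))}
    (hψ : ∀ j, IsGroundStateInSector (hubbardTorusTT' (Ls j) 1 s U) (rectN n (Ls j)) 0 (ψ (Ls j)))
    (hψ1 : ∀ j, star (ψ (Ls j)) ⬝ᵥ ψ (Ls j) = 1)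
    {ω : InfVolFermionState 2} (hω : ω.IsTorusLimitOf ψ Ls) :
    (c - ∑ k ∈ w, ‖a k‖ + (∑ σ : Fin 2, μ σ) * (n / 2 - ν)) +
      ((κ : ℚ) : ℝ) * (((cap : ℚ) : ℝ) - energyDensityTT' 1 s U n +
        (s - sv) * ω.meanEnergy (hubbardTTPrimeFermionInteraction 0 1 0) 1 +
        (U - Uv) * ω.meanEnergy (hubbardTTPrimeFermionInteraction 0 0 1) 1) +
      ((κ' : ℚ) : ℝ) * (energyDensityTT' 1 s U n -
        (s - sv) * ω.meanEnergy (hubbardTTPrimeFermionInteraction 0 1 0) 1 -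
        (U - Uv) * ω.meanEnergy (hubbardTTPrimeFermionInteraction 0 0 1) 1 - ((fl : ℚ) : ℝ)) +
      ((S.card : ℝ)⁻¹ * ∑ g ∈ S, (ω.expect (d4ShiftSet g 0 Λ') (fermionEmbed (PolySite.d4Emb g 0 Λ')
          (∑ k ∈ se, ((hubbardTTPrimeFermionInteraction 1 0 0).localHamiltonian Λ' * fermionEmbed (PolySite.incl hΛ) (B k) -
            fermionEmbed (PolySite.incl hΛ) (B k) * (hubbardTTPrimeFermionInteraction 1 0 0).localHamiltonian Λ')))).re +
        sv * ((S.card : ℝ)⁻¹ * ∑ g ∈ S, (ω.expect (d4ShiftSet g 0 Λ') (fermionEmbed (PolySite.d4Emb g 0 Λ')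
          (∑ k ∈ se, ((hubbardTTPrimeFermionInteraction 0 1 0).localHamiltonian Λ' * fermionEmbed (PolySite.incl hΛ) (B k) -
            fermionEmbed (PolySite.incl hΛ) (B k) * (hubbardTTPrimeFermionInteraction 0 1 0).localHamiltonian Λ')))).re) +
        Uv * ((S.card : ℝ)⁻¹ * ∑ g ∈ S, (ω.expect (d4ShiftSet g 0 Λ') (fermionEmbed (PolySite.d4Emb g 0 Λ')
          (∑ k ∈ se, ((hubbardTTPrimeFermionInteraction 0 0 1).localHamiltonian Λ' * fermionEmbed (PolySite.incl hΛ) (B k) -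
            fermionEmbed (PolySite.incl hΛ) (B k) * (hubbardTTPrimeFermionInteraction 0 0 1).localHamiltonian Λ')))).re)) ≤
      (S.card : ℝ)⁻¹ * ∑ g ∈ S, (ω.expect (d4ShiftSet g 0 Λ') (fermionEmbed (PolySite.d4Emb g 0 Λ') Xv)).re := by
  haveI : Nonempty ↥S := ⟨⟨1, h1⟩⟩
  have hS : (S.card : ℝ) ≠ 0 := by exact_mod_cast (Finset.card_pos.2 ⟨1, h1⟩).ne'
  -- names
  set Hv : FermionOp Λ' := (hubbardTTPrimeFermionInteraction 1 sv Uv).localHamiltonian Λ' with hHv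
  set H₀ : FermionOp Λ' := (hubbardTTPrimeFermionInteraction 1 0 0).localHamiltonian Λ' with hH₀
  set T' : FermionOp Λ' := (hubbardTTPrimeFermionInteraction 0 1 0).localHamiltonian Λ' with hT'
  set Dop : FermionOp Λ' := (hubbardTTPrimeFermionInteraction 0 0 1).localHamiltonian Λ' with hDop
  set Ev : FermionOp Λ' := fermionEmbed (PolySite.incl h0) ((hubbardTTPrimeFermionInteraction 1 sv Uv).meanEnergyObs 1) with hEv
  set EOM : FermionOp Λ' := ∑ k ∈ se, (Hv * fermionEmbed (PolySite.incl hΛ) (B k) - fermionEmbed (PolySite.incl hΛ) (B k) * Hv)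
    with hEOM
  set EOM₀ : FermionOp Λ' := ∑ k ∈ se, (H₀ * fermionEmbed (PolySite.incl hΛ) (B k) - fermionEmbed (PolySite.incl hΛ) (B k) * H₀)
    with hEOM₀
  set EOM₁ : FermionOp Λ' := ∑ k ∈ se, (T' * fermionEmbed (PolySite.incl hΛ) (B k) - fermionEmbed (PolySite.incl hΛ) (B k) * T')
    with hEOM₁
  set EOM₂ : FermionOp Λ' := ∑ k ∈ se, (Dop * fermionEmbed (PolySite.incl hΛ) (B k) - fermionEmbed (PolySite.incl hΛ) (B k) * Dop)
    with hEOM₂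
  set KE : FermionOp Λ' := (((κ : ℚ) : ℝ) : ℂ) • ((((cap : ℚ) : ℝ) : ℂ) • (1 : FermionOp Λ') - Ev) +
    (((κ' : ℚ) : ℝ) : ℂ) • (Ev - (((fl : ℚ) : ℝ) : ℂ) • (1 : FermionOp Λ')) with hKE
  set Xt : FermionOp Λ' := Xv - KE - EOM with hXt
  set e : ℝ := energyDensityTT' 1 s U n with he
  set K₂ : ℝ := ω.meanEnergy (hubbardTTPrimeFermionInteraction 0 1 0) 1 with hK₂
  set Dω : ℝ := ω.meanEnergy (hubbardTTPrimeFermionInteraction 0 0 1) 1 with hDω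
  -- (1) the identity, rearranged: objective `Xt`, `κ := 0`, EMPTY eom family
  have hcert' : Xt - (c : ℂ) • (1 : FermionOp Λ') -
      ∑ σ : Fin 2, ((μ σ : ℝ) : ℂ) • (nAt 0 hz σ - ((ν : ℝ) : ℂ) • (1 : FermionOp Λ')) -
      (((0 : ℝ) : ℝ) : ℂ) • ((((e : ℝ) : ℝ) : ℂ) • (1 : FermionOp Λ') -
        fermionEmbed (PolySite.incl h0) ((hubbardTTPrimeFermionInteraction 1 s U).meanEnergyObs 1)) =
      gramForm Λm O +
        (∑ k ∈ (∅ : Finset κι), ((hubbardTTPrimeFermionInteraction 1 s U).localHamiltonian Λ' * fermionEmbed (PolySite.incl hΛ) (B k) -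
            fermionEmbed (PolySite.incl hΛ) (B k) * (hubbardTTPrimeFermionInteraction 1 s U).localHamiltonian Λ') +
          ∑ l ∈ tt, (fermionEmbed (PolySite.incl (hsh l)) (fermionEmbed (PolySite.d4Emb (γ l) (wv l) Λ) (Y l)) -
            fermionEmbed (PolySite.incl hΛ) (Y l)) +
          ∑ j ∈ uu, b j • ladderWord (cw j)) +
        (∑ m' ∈ ah, ((dc m' : ℝ) : ℂ) • ((V m')ᴴ - V m') + ∑ k ∈ w, a k • ladderWord (word k)) := by
    rw [Complex.ofReal_zero, zero_smul, sub_zero, Finset.sum_empty, zero_add]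
    have ee : Xt - (c : ℂ) • (1 : FermionOp Λ') -
        ∑ σ : Fin 2, ((μ σ : ℝ) : ℂ) • (nAt 0 hz σ - ((ν : ℝ) : ℂ) • (1 : FermionOp Λ')) =
        (Xv - (c : ℂ) • (1 : FermionOp Λ') -
          ∑ σ : Fin 2, ((μ σ : ℝ) : ℂ) • (nAt 0 hz σ - ((ν : ℝ) : ℂ) • (1 : FermionOp Λ')) -
          (((κ : ℚ) : ℝ) : ℂ) • ((((cap : ℚ) : ℝ) : ℂ) • (1 : FermionOp Λ') - Ev) -
          (((κ' : ℚ) : ℝ) : ℂ) • (Ev - (((fl : ℚ) : ℝ) : ℂ) • (1 : FermionOp Λ'))) - EOM := by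
      rw [hXt, hKE]; abel
    rw [ee, hcert, hEOM]
    abel
  -- (2) the tree's soundness theorem at the state's point `(s, U)`
  have hmain := hω.re_sum_expect_d4_ge_of_window_certificate_TT'_ineq 1 s hU hn0 hn2 (κ := 0) (u := e) le_rfl le_rfl
    hΛ h8 h0 hz h1 hmul Xt μ ν hΛm O ∅ B tt γ hγS wv hsh Y uu b cw hcw ah dc V w a word hcert' hLs hψ hψ1
  -- (3) the dictionary values
  have hMv : ∀ g : DihedralGroup 4,
      (ω.expect (d4ShiftSet g 0 Λ') (fermionEmbed (PolySite.d4Emb g 0 Λ') Ev)).re = e + (Uv - U) * Dω + (sv - s) * K₂ := by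
    intro g
    rw [hEv, hω.re_expect_d4Emb_meanEnergyObs 1 sv Uv g h0 hLs, ω.meanEnergy_hubbardTTPrime_affine 1 s U sv Uv,
      hω.meanEnergy_hubbardTTPrime_eq_energyDensityTT' 1 s hU hn0 hn2 hLs hψ hψ1]
  have hEOMsplit : EOM = EOM₀ + ((sv : ℝ) : ℂ) • EOM₁ + ((Uv : ℝ) : ℂ) • EOM₂ := by
    rw [hEOM, hEOM₀, hEOM₁, hEOM₂, hHv, hH₀, hT', hDop]
    exact eom_two_split sv Uv hΛ se B
  -- (4) expand the objective in each rotated functional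
  have hexp : ∀ g : DihedralGroup 4,
      (ω.expect (d4ShiftSet g 0 Λ') (fermionEmbed (PolySite.d4Emb g 0 Λ') Xt)).re =
        (ω.expect (d4ShiftSet g 0 Λ') (fermionEmbed (PolySite.d4Emb g 0 Λ') Xv)).re -
          (((κ : ℚ) : ℝ) * (((cap : ℚ) : ℝ) - (e + (Uv - U) * Dω + (sv - s) * K₂)) +
            ((κ' : ℚ) : ℝ) * ((e + (Uv - U) * Dω + (sv - s) * K₂) - ((fl : ℚ) : ℝ))) -
          (ω.expect (d4ShiftSet g 0 Λ') (fermionEmbed (PolySite.d4Emb g 0 Λ') EOM₀)).re -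
          sv * (ω.expect (d4ShiftSet g 0 Λ') (fermionEmbed (PolySite.d4Emb g 0 Λ') EOM₁)).re -
          Uv * (ω.expect (d4ShiftSet g 0 Λ') (fermionEmbed (PolySite.d4Emb g 0 Λ') EOM₂)).re := by
    intro g
    rw [hXt, hEOMsplit, re_d4_expect_sub, re_d4_expect_sub, re_d4_expect_add ω g (EOM₀ + ((sv : ℝ) : ℂ) • EOM₁), re_d4_expect_add ω g EOM₀,
      re_d4_expect_smul, re_d4_expect_smul, hKE,
      re_d4_expect_add, re_d4_expect_smul, re_d4_expect_smul, re_d4_expect_sub, re_d4_expect_sub, re_d4_expect_smul_one,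
      re_d4_expect_smul_one, hMv g]
    ring
  -- (5) sum over the orbit
  have hsum : (S.card : ℝ)⁻¹ * ∑ g ∈ S, (ω.expect (d4ShiftSet g 0 Λ') (fermionEmbed (PolySite.d4Emb g 0 Λ') Xt)).re =
      (S.card : ℝ)⁻¹ * ∑ g ∈ S, (ω.expect (d4ShiftSet g 0 Λ') (fermionEmbed (PolySite.d4Emb g 0 Λ') Xv)).re -
        (((κ : ℚ) : ℝ) * (((cap : ℚ) : ℝ) - (e + (Uv - U) * Dω + (sv - s) * K₂)) +
          ((κ' : ℚ) : ℝ) * ((e + (Uv - U) * Dω + (sv - s) * K₂) - ((fl : ℚ) : ℝ))) -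
        (S.card : ℝ)⁻¹ * ∑ g ∈ S, (ω.expect (d4ShiftSet g 0 Λ') (fermionEmbed (PolySite.d4Emb g 0 Λ') EOM₀)).re -
        sv * ((S.card : ℝ)⁻¹ * ∑ g ∈ S, (ω.expect (d4ShiftSet g 0 Λ') (fermionEmbed (PolySite.d4Emb g 0 Λ') EOM₁)).re) -
        Uv * ((S.card : ℝ)⁻¹ * ∑ g ∈ S, (ω.expect (d4ShiftSet g 0 Λ') (fermionEmbed (PolySite.d4Emb g 0 Λ') EOM₂)).re) := by
    rw [Finset.sum_congr rfl fun g _ => hexp g, Finset.sum_sub_distrib, Finset.sum_sub_distrib, Finset.sum_sub_distrib,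
      Finset.sum_sub_distrib, Finset.sum_const, nsmul_eq_mul, ← Finset.mul_sum, ← Finset.mul_sum]
    field_simp
  rw [hsum] at hmain
  linarith

end Vertex

/-! ## §3  (E₂): the shared eom functional vanishes at the state's own point `(s, U)` -/

section Stationarity

/-- **(E₂) — stationarity, two couplings.** `E₀₀ω + s·E₁ω + U·E₂ω = 0` for every torus limit `ω` of unit sector ground states at `(1, s, U)`:
the orbit mean of `Re ω([H^{(1,s,U)}_{Λ'}, Γ(Σ_k B_k)])`, zero by `CARPolyWindow.orbitMean_re_commutator_eq_zero`. [cite: Han2020Bootstrap, §3] -/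
theorem pinnedStationarity₂ {U : ℝ} (hU : 0 ≤ U) {n : ℝ} (hn0 : 0 ≤ n) (hn2 : n < 2) (s : ℝ)
    {Λ Λ' : Finset (Site 2)} (hΛ : Λ ⊆ Λ') (h8 : thicken Λ 1 ⊆ Λ')
    (h0 : thicken ({0} : Finset (Site 2)) 1 ⊆ Λ') (hz : (0 : Site 2) ∈ Λ')
    {S : Finset (DihedralGroup 4)} (h1 : (1 : DihedralGroup 4) ∈ S) (hmul : ∀ a ∈ S, ∀ b ∈ S, a * b ∈ S)
    {κι : Type*} (se : Finset κι) (B : κι → FermionOp Λ)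
    {Ls : ℕ → ℕ} (hLs : Tendsto Ls atTop atTop) {ψ : ∀ L, Fock (Orb (FermionTorus 2 L))}
    (hψ : ∀ j, IsGroundStateInSector (hubbardTorusTT' (Ls j) 1 s U) (rectN n (Ls j)) 0 (ψ (Ls j)))
    (hψ1 : ∀ j, star (ψ (Ls j)) ⬝ᵥ ψ (Ls j) = 1) {ω : InfVolFermionState 2} (hω : ω.IsTorusLimitOf ψ Ls) :
    (S.card : ℝ)⁻¹ * ∑ g ∈ S, (ω.expect (d4ShiftSet g 0 Λ') (fermionEmbed (PolySite.d4Emb g 0 Λ')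
        (∑ k ∈ se, ((hubbardTTPrimeFermionInteraction 1 0 0).localHamiltonian Λ' * fermionEmbed (PolySite.incl hΛ) (B k) -
          fermionEmbed (PolySite.incl hΛ) (B k) * (hubbardTTPrimeFermionInteraction 1 0 0).localHamiltonian Λ')))).re +
      s * ((S.card : ℝ)⁻¹ * ∑ g ∈ S, (ω.expect (d4ShiftSet g 0 Λ') (fermionEmbed (PolySite.d4Emb g 0 Λ')
        (∑ k ∈ se, ((hubbardTTPrimeFermionInteraction 0 1 0).localHamiltonian Λ' * fermionEmbed (PolySite.incl hΛ) (B k) -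
          fermionEmbed (PolySite.incl hΛ) (B k) * (hubbardTTPrimeFermionInteraction 0 1 0).localHamiltonian Λ')))).re) +
      U * ((S.card : ℝ)⁻¹ * ∑ g ∈ S, (ω.expect (d4ShiftSet g 0 Λ') (fermionEmbed (PolySite.d4Emb g 0 Λ')
        (∑ k ∈ se, ((hubbardTTPrimeFermionInteraction 0 0 1).localHamiltonian Λ' * fermionEmbed (PolySite.incl hΛ) (B k) -
          fermionEmbed (PolySite.incl hΛ) (B k) * (hubbardTTPrimeFermionInteraction 0 0 1).localHamiltonian Λ')))).re) = 0 := by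
  have hz0 := CARPolyWindow.orbitMean_re_commutator_eq_zero s hU hn0 hn2 hΛ h8 h0 hz h1 hmul (∑ k ∈ se, B k) hLs hψ hψ1 hω
  rw [← eom_sum_eq_commutator_sum _ hΛ se B, eom_two_split s U hΛ se B] at hz0
  simp_rw [re_d4_expect_add, re_d4_expect_smul] at hz0
  rw [Finset.sum_add_distrib, Finset.sum_add_distrib, ← Finset.mul_sum, ← Finset.mul_sum] at hz0
  linear_combination hz0

end Stationarity

end Summit.Ventures.CertifiedManyBodySolver.Downfold

end
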